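import Mathlib
import HarnessLib
import Summits.NavierStokesRegularity.NavierStokesRegularity.Theorems.CompletionRelayChainDefs

/-!
# `CompletionRelayChain` — crux `RelayFrontStep` (item stmt-NavierStokesRegularity-24850):
  profile arithmetic of the repaired window `W₂` (helper for LINE `window_v2`, stubs `stub_tail`,
  `stub_wake`, `stub_front`)

Scalar facts about the clause profiles of `Theorems/CompletionRelayChainDefs.lean` in base `2`, with
`P K = 2^{−12(K−1)}`: for `K ≥ 2`, `idleE K = 5e-11·P(K)²`, `aheadE K = ½(5e-10·4096)²·P(K)²`,
`relayEnv₂ K = 2·P(K)²` (`K ≥ 3`); `P(K+1) = P K/4096`; the clock against the profile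
`2^{5K/2}·P K ≤ 2^{−26}` (`K ≥ 4`); `2^{5} = 32`, `2^{15/2} ≤ 181.1`, `√2 ≤ 1.4143`; the tail
start-energy bound of a `W₂`-start: every partial sum of `Σᵢ F₀ i (K+j)` over `j` is
`≤ Est K := 2(3·aheadE K + idleE K)` (geometric domination, ratio `≤ 1/2`), with `Est K = cE·P(K)²`,
`√(Est K) ≥ 1e-5·P K`, `√(Est 3) ≤ 1e-12`, `2√(Est 4) ≥ 1.3e-16`.

No definitions. HONEST FRAMING: arithmetic of MODEL-lattice clause profiles; helper for the crux, no
stub credit; nothing here is a statement about the Navier–Stokes equations.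
-/

noncomputable section

-- the summit-side namespace `Summit.NavierStokesRegularity.NavierStokesRegularity.…` (single-conjunct summit,
-- D-0017) repeats a component by design; the dupNamespace linter would flag every declaration.
set_option linter.dupNamespace false

open Literature.Analysis.FluidPDE.TaoCascade

namespace Summit.NavierStokesRegularity.NavierStokesRegularity.Cruxes.RelayFrontStep.Window2

/-! ### Scalar profile facts (base `2`) -/

/-- `64^y = 2^{6y}`. -/
theorem rpow64_eq (y : ℝ) : (64 : ℝ) ^ y = (2 : ℝ) ^ (6 * y) := by
  rw [show (64 : ℝ) = (2 : ℝ) ^ (6 : ℝ) by norm_num, ← Real.rpow_mul (by norm_num)]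

/-- The far-ahead clause in base `2`: `aheadE K = ½·(5e-10)²·4096²·(2^{−12(K−1)})²`. -/
theorem aheadE_eq (K : ℤ) :
    aheadE K = (1 / 2) * ((5 / 10 ^ 10) * 4096) ^ 2 * ((2 : ℝ) ^ (-(12 : ℝ) * ((K : ℝ) - 1))) ^ 2 := by
  unfold aheadE
  rw [rpow64_eq]
  have : (2 : ℝ) ^ (6 * (-(2 : ℝ) * ((K : ℝ) - 2))) = 4096 * (2 : ℝ) ^ (-(12 : ℝ) * ((K : ℝ) - 1)) := by
    rw [show (6 * (-(2 : ℝ) * ((K : ℝ) - 2))) = (12 : ℝ) + (-(12 : ℝ) * ((K : ℝ) - 1)) by ring,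
      Real.rpow_add (by norm_num)]
    norm_num
  rw [this]
  ring

/-- The idle clause in base `2` for `K ≥ 2`: `idleE K = 5e-11·(2^{−12(K−1)})²`. -/
theorem idleE_eq {K : ℤ} (hK : 2 ≤ K) :
    idleE K = (1 / 2) * (1 / 10 ^ 10) * ((2 : ℝ) ^ (-(12 : ℝ) * ((K : ℝ) - 1))) ^ 2 := by
  unfold idleE
  rw [if_neg (by omega), rpow64_eq, ← Real.rpow_two, ← Real.rpow_mul (by norm_num)]
  congr 1
  ring_nf

/-- The epoch envelope in base `2` for `K ≥ 3`: `relayEnv₂ K = 2·(2^{−12(K−1)})²`. -/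
theorem relayEnv₂_eq {K : ℤ} (hK : 3 ≤ K) :
    relayEnv₂ K = 2 * ((2 : ℝ) ^ (-(12 : ℝ) * ((K : ℝ) - 1))) ^ 2 := by
  unfold relayEnv₂
  rw [if_neg (by omega), rpow64_eq, ← Real.rpow_two, ← Real.rpow_mul (by norm_num)]
  congr 1
  ring_nf

/-- One shell further: `2^{−12((K+1)−1)} = 2^{−12}·2^{−12(K−1)}`. -/
theorem P_succ (K : ℤ) :
    (2 : ℝ) ^ (-(12 : ℝ) * (((K + 1 : ℤ) : ℝ) - 1)) = (1 / 4096) * (2 : ℝ) ^ (-(12 : ℝ) * ((K : ℝ) - 1)) := by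
  push_cast
  rw [show -(12 : ℝ) * ((K : ℝ) + 1 - 1) = -(12 : ℝ) * ((K : ℝ) - 1) - (12 : ℕ) by push_cast; ring,
    Real.rpow_sub (by norm_num), Real.rpow_natCast]
  norm_num
  ring

/-- The same with `1 + k`: `2^{−12((1+k)−1)} = 2^{−12}·2^{−12(k−1)}`. -/
theorem P_one_add (k : ℤ) :
    (2 : ℝ) ^ (-(12 : ℝ) * (((1 + k : ℤ) : ℝ) - 1)) = (1 / 4096) * (2 : ℝ) ^ (-(12 : ℝ) * ((k : ℝ) - 1)) := by
  rw [add_comm]; exact P_succ k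

/-- The clock against the profile: `2^{5K/2}·2^{−12(K−1)} ≤ 2^{−26}` for `K ≥ 4`. -/
theorem clock_mul_P_le {K : ℤ} (hK : 4 ≤ K) :
    (1 + 1 : ℝ) ^ ((5 : ℝ) * (K : ℝ) / 2) * (2 : ℝ) ^ (-(12 : ℝ) * ((K : ℝ) - 1)) ≤ 1 / 2 ^ 26 := by
  rw [show (1 + 1 : ℝ) = 2 by norm_num, ← Real.rpow_add (by norm_num)]
  have hK' : (4 : ℝ) ≤ K := by exact_mod_cast hK
  have hexp : (5 : ℝ) * (K : ℝ) / 2 + -(12 : ℝ) * ((K : ℝ) - 1) ≤ -((26 : ℕ) : ℝ) := by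
    push_cast; nlinarith
  calc (2 : ℝ) ^ ((5 : ℝ) * (K : ℝ) / 2 + -(12 : ℝ) * ((K : ℝ) - 1))
      ≤ (2 : ℝ) ^ (-((26 : ℕ) : ℝ)) := Real.rpow_le_rpow_of_exponent_le (by norm_num) hexp
    _ = 1 / 2 ^ 26 := by rw [Real.rpow_neg (by norm_num), Real.rpow_natCast]; norm_num

/-- `2^{5·(3−1)/2} = 32`. -/
theorem clock_two : (1 + 1 : ℝ) ^ ((5 : ℝ) * (((3 - 1 : ℤ) : ℝ)) / 2) = 32 := by
  have : (5 : ℝ) * (((3 - 1 : ℤ) : ℝ)) / 2 = ((5 : ℕ) : ℝ) := by push_cast; norm_num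
  rw [this, Real.rpow_natCast]; norm_num

/-- `2^{5·(4−1)/2} ≤ 181.1`. -/
theorem clock_three_le : (1 + 1 : ℝ) ^ ((5 : ℝ) * (((4 - 1 : ℤ) : ℝ)) / 2) ≤ 1811 / 10 := by
  have : (5 : ℝ) * (((4 - 1 : ℤ) : ℝ)) / 2 = ((7 : ℕ) : ℝ) + 1 / 2 := by push_cast; norm_num
  rw [this, Real.rpow_add (by norm_num), Real.rpow_natCast, ← Real.sqrt_eq_rpow]
  have h2 : Real.sqrt (1 + 1 : ℝ) ≤ 14143 / 10000 :=
    calc Real.sqrt (1 + 1 : ℝ) ≤ Real.sqrt ((14143 / 10000 : ℝ) ^ 2) := Real.sqrt_le_sqrt (by norm_num)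
      _ = 14143 / 10000 := Real.sqrt_sq (by norm_num)
  nlinarith [Real.sqrt_nonneg (1 + 1 : ℝ)]

/-- `P 3 = 2^{−24}` numerically. -/
theorem P_three : (2 : ℝ) ^ (-(12 : ℝ) * (((3 : ℤ) : ℝ) - 1)) = 1 / 2 ^ 24 := by
  rw [show -(12 : ℝ) * (((3 : ℤ) : ℝ) - 1) = -((24 : ℕ) : ℝ) by push_cast; norm_num,
    Real.rpow_neg (by norm_num), Real.rpow_natCast]
  norm_num

/-- `P 4 = 2^{−36}` numerically. -/
theorem P_four : (2 : ℝ) ^ (-(12 : ℝ) * (((4 : ℤ) : ℝ) - 1)) = 1 / 2 ^ 36 := by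
  rw [show -(12 : ℝ) * (((4 : ℤ) : ℝ) - 1) = -((36 : ℕ) : ℝ) by push_cast; norm_num,
    Real.rpow_neg (by norm_num), Real.rpow_natCast]
  norm_num

/-! ### Start energies above a shell -/

/-- Geometric domination of the per-shell start-energy bound `e k = 3·aheadE k + idleE k` (`k ≥ 2`):
`e (k+1) ≤ e k / 2`. -/
theorem shellBound_succ_le {k : ℤ} (hk : 2 ≤ k) :
    3 * aheadE (k + 1) + idleE (k + 1) ≤ (3 * aheadE k + idleE k) / 2 := by
  rw [aheadE_eq, aheadE_eq, idleE_eq hk, idleE_eq (by omega), P_succ]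
  have hP : 0 ≤ ((2 : ℝ) ^ (-(12 : ℝ) * ((k : ℝ) - 1))) ^ 2 := sq_nonneg _
  nlinarith

/-- Every partial sum of the start energies over the shells `≥ K` (`K ≥ 2`) of a `W₂`-start is at most
`Est K = 2·(3·aheadE K + idleE K)`. -/
theorem tail_start_le {F₀ : Fin 4 → ℤ → ℝ}
    (hahead : ∀ k : ℤ, 2 ≤ k → ∀ i : Fin 4, i ≠ 3 → F₀ i k ≤ aheadE k)
    (hidle : ∀ k : ℤ, F₀ 3 k ≤ idleE k) {K : ℤ} (hK : 2 ≤ K) (L : ℕ) :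
    ∑ j ∈ Finset.range L, ∑ i, F₀ i (K + j) ≤ 2 * (3 * aheadE K + idleE K) := by
  -- per shell
  have hshell : ∀ k : ℤ, 2 ≤ k → ∑ i, F₀ i k ≤ 3 * aheadE k + idleE k := by
    intro k hk
    rw [Fin.sum_univ_four]
    have h0 := hahead k hk 0 (by decide)
    have h1 := hahead k hk 1 (by decide)
    have h2 := hahead k hk 2 (by decide)
    have h3 := hidle k
    linarith
  -- geometric domination along the tail
  have hgeom : ∀ j : ℕ, 3 * aheadE (K + j) + idleE (K + j) ≤ (3 * aheadE K + idleE K) * (1 / 2) ^ j := by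
    intro j
    induction j with
    | zero => simp
    | succ j ih =>
      have hstep := shellBound_succ_le (k := K + j) (by omega)
      rw [show K + ((j + 1 : ℕ) : ℤ) = K + j + 1 by push_cast; ring, pow_succ]
      have hnn : (0 : ℝ) ≤ (1 / 2) ^ j := by positivity
      nlinarith
  have hpos : 0 ≤ 3 * aheadE K + idleE K := by
    unfold aheadE idleE; split_ifs <;> positivity
  calc ∑ j ∈ Finset.range L, ∑ i, F₀ i (K + j)
      ≤ ∑ j ∈ Finset.range L, (3 * aheadE K + idleE K) * (1 / 2 : ℝ) ^ j :=
        Finset.sum_le_sum fun j _ => (hshell (K + j) (by omega)).trans (hgeom j)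
    _ = (3 * aheadE K + idleE K) * ∑ j ∈ Finset.range L, (1 / 2 : ℝ) ^ j := by
        rw [Finset.mul_sum]
    _ ≤ (3 * aheadE K + idleE K) * 2 :=
        mul_le_mul_of_nonneg_left (sum_geometric_two_le L) hpos
    _ = 2 * (3 * aheadE K + idleE K) := by ring


/-! ### The tail start-energy bound in closed form and its numerics -/

/-- `Est K = cE · P(K)²` for `K ≥ 2`. -/
theorem est_eq {K : ℤ} (hK : 2 ≤ K) :
    2 * (3 * aheadE K + idleE K) =
      (2 * (3 * ((1 / 2) * ((5 / 10 ^ 10) * 4096) ^ 2) + (1 / 2) * (1 / 10 ^ 10))) *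
        ((2 : ℝ) ^ (-(12 : ℝ) * ((K : ℝ) - 1))) ^ 2 := by
  rw [aheadE_eq, idleE_eq hK]; ring

/-- Lower bound `1e-5 · P K ≤ √(Est K)` (`K ≥ 2`). -/
theorem sqrt_est_ge {K : ℤ} (hK : 2 ≤ K) :
    (1 / 10 ^ 5) * (2 : ℝ) ^ (-(12 : ℝ) * ((K : ℝ) - 1)) ≤ Real.sqrt (2 * (3 * aheadE K + idleE K)) := by
  have hP : 0 < (2 : ℝ) ^ (-(12 : ℝ) * ((K : ℝ) - 1)) := Real.rpow_pos_of_pos (by norm_num) _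
  refine Real.le_sqrt_of_sq_le ?_
  rw [est_eq hK]
  nlinarith [sq_nonneg ((2 : ℝ) ^ (-(12 : ℝ) * ((K : ℝ) - 1)))]

/-- `Est K ≥ 0`. -/
theorem est_nonneg (K : ℤ) : 0 ≤ 2 * (3 * aheadE K + idleE K) := by
  unfold aheadE idleE; split_ifs <;> positivity

/-- `√(Est 3) ≤ 1e-12`. -/
theorem sqrt_est_three_le : Real.sqrt (2 * (3 * aheadE 3 + idleE 3)) ≤ 1 / 10 ^ 12 := by
  rw [Real.sqrt_le_left (by norm_num), est_eq (by norm_num), P_three]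
  norm_num

/-- `1.3e-16 ≤ 2·√(Est 4)`. -/
theorem two_sqrt_est_four_ge : (13 / 10 ^ 17 : ℝ) ≤ 2 * Real.sqrt (2 * (3 * aheadE 4 + idleE 4)) := by
  have h : (13 / 10 ^ 17 / 2 : ℝ) ≤ Real.sqrt (2 * (3 * aheadE 4 + idleE 4)) := by
    refine Real.le_sqrt_of_sq_le ?_
    rw [est_eq (by norm_num), P_four]
    norm_num
  linarith

/-- `√2 ≤ 1.4143`. -/
theorem sqrt_two_le : Real.sqrt 2 ≤ 14143 / 10000 :=
  calc Real.sqrt 2 ≤ Real.sqrt ((14143 / 10000 : ℝ) ^ 2) := Real.sqrt_le_sqrt (by norm_num)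
    _ = 14143 / 10000 := Real.sqrt_sq (by norm_num)

end Summit.NavierStokesRegularity.NavierStokesRegularity.Cruxes.RelayFrontStep.Window2
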